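import Literature.Computability.AlgebraicComplexity.Bur24UnboundedDegreeClassesField
import Literature.Computability.AlgebraicComplexity.VNPClosedUnderDifferentiation
import HarnessLib

/-!
# Power substitutions `Z ↦ X^{2^ℓ}`: from `VP`, `VNP` to `VPnb`, `VNPnb` (Bürgisser 2024, §4.2)

P. Bürgisser, *Completeness classes in algebraic complexity theory*, arXiv:2406.06217 (2024), §4.2
(p. 16 of the held text, lines 20–25): "A straightforward way to obtain a sequence in `VPnb^𝔽` is to
take a sequence `(f_n)` in `VP^𝔽` and to apply substitutions `Z ↦ X^{2^ℓ}` to the variables `Z` of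
`f_n`, where `ℓ` is polynomially bounded in `n` (repeated squaring).  Similarly, applying such
substitutions to a sequence in `VNP^𝔽`, we obtain a sequence in `VNPnb^𝔽`.  One may ask whether all
sequences in `VNPnb^𝔽` may be obtained this way.  Corollary 4.7 below shows that this is indeed
the case over finite fields!"; and Theorem 4.8 "⇒" (p. 17 L33–L36: "This is immediate from
Corollary 4.7").

In the tree's vocabulary (`IsVPFamily`/`IsVNPFamily`, `ValiantClasses.lean`; `IsVPnbFamily`/
`IsVNPnbFamily`, `Bur24UnboundedDegreeClassesField.lean`), over every commutative ring `k`: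

* `IsVPnbFamily.aeval`, `IsVNPnbFamily.aeval` — the unbounded-degree classes are closed under
  substituting tuples of polynomials of `p`-bounded TOTAL CIRCUIT SIZE (no degree hypothesis; for
  `VNPnb` the substitution enters the free variables of the Boolean sum, `boolSum_aeval_extend`);
* `complexity_X_pow_two_pow_le` — `L(X^{2^ℓ}) ≤ ℓ` (repeated squaring);
* `IsVPFamily.isVPnbFamily_powerSubst`, `IsVNPFamily.isVNPnbFamily_powerSubst` — **the two printed
  sentences**: substituting `Z ↦ X_{v(Z)}^{2^{ℓ(Z)}}` with `ℓ` `p`-bounded into a `VP` (resp. `VNP`)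
  family gives a `VPnb` (resp. `VNPnb`) family (also from `VPnb`, `VNPnb` inputs:
  `IsVPnbFamily.powerSubst`, `IsVNPnbFamily.powerSubst`);
* `Bur24_thm_4_8_mp_of_normalForm` — **Theorem 4.8 "⇒" reduced to Corollary 4.7** as printed: IF
  every `VNPnb` family is a power substitution of a `VNP` family (the normal form of Cor. 4.7, here
  an explicit hypothesis — Malod's theorem is not in the tree), THEN `VNP ⊆ VP` implies
  `VNPnb ⊆ VPnb`.  (The converse implication, Rem. 4.9, is the tree's `Bur24_rem_4_9`.)

Theorems only; no definitions, no named facts.  Cor. 4.7 / Thm. 4.6 (Malod 2007) are NOT proved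
here.

## References

* [Burgisser2024Completeness] P. Bürgisser, arXiv:2406.06217 (2024), §4.2 (p0016 L20–L25), Thm. 4.8
  (p0017 L27–L36).
-/

noncomputable section

open MvPolynomial

namespace Literature.Computability.AlgebraicComplexity

universe u v w

variable {k : Type u} [CommRing k] {σ : ℕ → Type v} {τ : ℕ → Type w} [∀ n, Fintype (σ n)]
  [∀ n, Fintype (τ n)]

/-! ## §1. Substitution closure of the unbounded-degree classes -/

/-- **`VPnb` is closed under substitutions of `p`-bounded total size**: if `(f_n) ∈ VPnb^k`,
`f_n ∈ k[σ_n]`, and `g_n = (g_{n,i})_{i ∈ σ_n}` are tuples of polynomials in `k[τ_n]` with `#τ_n` and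
`Σ_i L(g_{n,i})` `p`-bounded, then `(f_n(g_n))_n ∈ VPnb^k` — `L(f(g)) ≤ L(f) + Σ_i L(g_i)`
(`complexity_aeval_le`); no degree bookkeeping is needed in the unbounded-degree class.
[cite: Burgisser2024Completeness, §4.2 (p0016 L20–L22)] -/
theorem IsVPnbFamily.aeval {f : ∀ n, MvPolynomial (σ n) k} (hf : IsVPnbFamily f)
    (g : ∀ n, σ n → MvPolynomial (τ n) k) (hτ : IsPBounded fun n => Fintype.card (τ n))
    (hgc : IsPBounded fun n => ∑ i, complexity (g n i)) :
    IsVPnbFamily fun n => MvPolynomial.aeval (g n) (f n) := by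
  rw [isVPnbFamily_iff_isPComputable] at hf ⊢
  exact ⟨hτ, (IsPBounded.add_holds hf.2 hgc).mono fun n => complexity_aeval_le (f n) (g n)⟩

/-- **`VNPnb` is closed under substitutions of `p`-bounded total size** (substitute into the free
variables of the Boolean sum, `boolSum_aeval_extend`). [cite: Burgisser2024Completeness, §4.2 (p0016 L22–L23)] -/
theorem IsVNPnbFamily.aeval {f : ∀ n, MvPolynomial (σ n) k} (hf : IsVNPnbFamily f)
    (g : ∀ n, σ n → MvPolynomial (τ n) k) (hτ : IsPBounded fun n => Fintype.card (τ n))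
    (hgc : IsPBounded fun n => ∑ i, complexity (g n i)) :
    IsVNPnbFamily fun n => MvPolynomial.aeval (g n) (f n) := by
  classical
  obtain ⟨u, G, hG, hfG⟩ := hf
  have hu : IsPBounded u := hG.1.mono fun n => by simp [Fintype.card_sum]
  let θ : ∀ n, (σ n ⊕ Fin (u n)) → MvPolynomial (τ n ⊕ Fin (u n)) k := fun n =>
    Sum.elim (fun i => rename Sum.inl (g n i)) (fun j => X (Sum.inr j))
  have hθ : IsVPnbFamily fun n => MvPolynomial.aeval (θ n) (G n) := by
    refine IsVPnbFamily.aeval hG θ ((IsPBounded.add_holds hτ hu).mono fun n => by simp)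
      (hgc.mono fun n => ?_)
    rw [Fintype.sum_sum_type]
    have h2 : ∑ j : Fin (u n), complexity (θ n (Sum.inr j)) = 0 :=
      Finset.sum_eq_zero fun j _ => complexity_X_holds _
    rw [h2, add_zero]
    exact Finset.sum_le_sum fun i _ => complexity_rename_le_holds' _ _
  refine ⟨u, fun n => MvPolynomial.aeval (θ n) (G n), hθ, fun n => ?_⟩
  beta_reduce
  rw [hfG n, boolSum_aeval_extend]

/-! ## §2. Repeated squaring and the power substitutions `Z ↦ X^{2^ℓ}` -/

/-- **Repeated squaring**: `L(X_v^{2^ℓ}) ≤ ℓ`. [cite: Burgisser2024Completeness, §4.2 (p0016 L22)] -/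
theorem complexity_X_pow_two_pow_le {ρ : Type*} (v : ρ) (ℓ : ℕ) :
    complexity ((X v : MvPolynomial ρ k) ^ 2 ^ ℓ) ≤ ℓ := by
  -- `X^{2^{ℓ+1}} = (X²)^{2^ℓ}`: the circuit for `T^{2^ℓ}` fed with the one-gate circuit for `X²`
  induction ℓ generalizing ρ with
  | zero => rw [pow_zero, pow_one, complexity_X_holds]
  | succ ℓ ih =>
    have h := complexity_aeval_le ((X PUnit.unit : MvPolynomial PUnit k) ^ 2 ^ ℓ)
      (fun _ => (X v : MvPolynomial ρ k) ^ 2)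
    rw [map_pow, aeval_X, ← pow_mul, ← pow_succ'] at h
    refine h.trans ?_
    have h2 : complexity ((X v : MvPolynomial ρ k) ^ 2) ≤ 1 := by
      rw [sq]
      have := complexity_mul_le_holds (X v : MvPolynomial ρ k) (X v)
      rw [complexity_X_holds] at this
      omega
    have := ih PUnit.unit
    rw [Fintype.sum_unique]
    omega

omit [∀ n, Fintype (τ n)] in
/-- The power substitution `Z ↦ X_{v(Z)}^{2^{ℓ(Z)}}` has total size `≤ #σ_n · max_Z ℓ(Z)`.
[cite: Burgisser2024Completeness, §4.2 (p0016 L20–L22)] -/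
theorem sum_complexity_X_pow_two_pow_le (n : ℕ) (v : σ n → τ n) (ℓ : σ n → ℕ) :
    ∑ z, complexity ((X (v z) : MvPolynomial (τ n) k) ^ 2 ^ ℓ z) ≤
      Fintype.card (σ n) * Finset.univ.sup ℓ := by
  refine (Finset.sum_le_sum fun z _ => (complexity_X_pow_two_pow_le (k := k) (v z) (ℓ z)).trans
    (Finset.le_sup (f := ℓ) (Finset.mem_univ z))).trans ?_
  rw [Finset.sum_const, smul_eq_mul, Finset.card_univ]

/-- **`VPnb` is closed under the power substitutions `Z ↦ X^{2^ℓ}`, `ℓ` `p`-bounded.**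
[cite: Burgisser2024Completeness, §4.2 (p0016 L20–L22)] -/
theorem IsVPnbFamily.powerSubst {f : ∀ n, MvPolynomial (σ n) k} (hf : IsVPnbFamily f)
    (v : ∀ n, σ n → τ n) (ℓ : ∀ n, σ n → ℕ) (hτ : IsPBounded fun n => Fintype.card (τ n))
    (hℓ : IsPBounded fun n => Finset.univ.sup (ℓ n)) :
    IsVPnbFamily fun n =>
      MvPolynomial.aeval (fun z => (X (v n z) : MvPolynomial (τ n) k) ^ 2 ^ ℓ n z) (f n) :=
  hf.aeval _ hτ ((IsPBounded.mul_holds hf.1 hℓ).mono fun n => sum_complexity_X_pow_two_pow_le n _ _)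

/-- **Bürgisser 2024, §4.2 (p0016 L20–L22): "A straightforward way to obtain a sequence in `VPnb^𝔽`
is to take a sequence `(f_n)` in `VP^𝔽` and to apply substitutions `Z ↦ X^{2^ℓ}` to the variables
`Z` of `f_n`, where `ℓ` is polynomially bounded in `n` (repeated squaring)."**  Here: every
commutative ring `k`; the substitution sends the variable `Z ∈ σ_n` to `X_{v_n(Z)}^{2^{ℓ_n(Z)}}` for
arbitrary `v_n : σ_n → τ_n` with `#τ_n` `p`-bounded. [cite: Burgisser2024Completeness, §4.2 (p0016 L20–L22)] -/
theorem IsVPFamily.isVPnbFamily_powerSubst {f : ∀ n, MvPolynomial (σ n) k} (hf : IsVPFamily f)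
    (v : ∀ n, σ n → τ n) (ℓ : ∀ n, σ n → ℕ) (hτ : IsPBounded fun n => Fintype.card (τ n))
    (hℓ : IsPBounded fun n => Finset.univ.sup (ℓ n)) :
    IsVPnbFamily fun n =>
      MvPolynomial.aeval (fun z => (X (v n z) : MvPolynomial (τ n) k) ^ 2 ^ ℓ n z) (f n) :=
  hf.isVPnbFamily.powerSubst v ℓ hτ hℓ

/-- **`VNPnb` is closed under the power substitutions `Z ↦ X^{2^ℓ}`, `ℓ` `p`-bounded.**
[cite: Burgisser2024Completeness, §4.2 (p0016 L22–L23)] -/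
theorem IsVNPnbFamily.powerSubst {f : ∀ n, MvPolynomial (σ n) k} (hf : IsVNPnbFamily f)
    (v : ∀ n, σ n → τ n) (ℓ : ∀ n, σ n → ℕ) (hτ : IsPBounded fun n => Fintype.card (τ n))
    (hℓ : IsPBounded fun n => Finset.univ.sup (ℓ n)) :
    IsVNPnbFamily fun n =>
      MvPolynomial.aeval (fun z => (X (v n z) : MvPolynomial (τ n) k) ^ 2 ^ ℓ n z) (f n) := by
  obtain ⟨u, G, hG, hfG⟩ := hf
  have hσ : IsPBounded fun n => Fintype.card (σ n) := hG.1.mono fun n => by simp [Fintype.card_sum]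
  exact IsVNPnbFamily.aeval ⟨u, G, hG, hfG⟩ _ hτ
    ((IsPBounded.mul_holds hσ hℓ).mono fun n => sum_complexity_X_pow_two_pow_le n _ _)

/-- **Bürgisser 2024, §4.2 (p0016 L22–L23): "Similarly, applying such substitutions to a sequence
in `VNP^𝔽`, we obtain a sequence in `VNPnb^𝔽`."** [cite: Burgisser2024Completeness, §4.2 (p0016 L22–L23)] -/
theorem IsVNPFamily.isVNPnbFamily_powerSubst {f : ∀ n, MvPolynomial (σ n) k} (hf : IsVNPFamily f)
    (v : ∀ n, σ n → τ n) (ℓ : ∀ n, σ n → ℕ) (hτ : IsPBounded fun n => Fintype.card (τ n))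
    (hℓ : IsPBounded fun n => Finset.univ.sup (ℓ n)) :
    IsVNPnbFamily fun n =>
      MvPolynomial.aeval (fun z => (X (v n z) : MvPolynomial (τ n) k) ^ 2 ^ ℓ n z) (f n) :=
  hf.isVNPnbFamily.powerSubst v ℓ hτ hℓ

/-! ## §3. Theorem 4.8 "⇒" reduced to the normal form of Corollary 4.7 -/

/-- **Bürgisser 2024, Thm. 4.8 "⇒" ("This is immediate from Corollary 4.7")**, as the reduction it
is: over a commutative ring `k`, IF every `VNPnb^k` family in the variables `Fin (w n)` is obtained
from some `VNP^k` family by power substitutions `Z ↦ X^{2^ℓ}` with `ℓ` `p`-bounded (the normal form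
of Cor. 4.7 — Malod's theorem for `k = 𝔽_p`, NOT proved in the tree, taken here as the explicit
hypothesis `hNF`), THEN `VNP^k ⊆ VP^k` implies `VNPnb^k ⊆ VPnb^k` (families in standard variables
`Fin (w n)`; the source families of the normal form range over variables `Fin (a n)`).
[cite: Burgisser2024Completeness, Thm. 4.8 and Cor. 4.7 (p0017 L22–L36)] -/
theorem Bur24_thm_4_8_mp_of_normalForm
    (hNF : ∀ (w : ℕ → ℕ) (f : ∀ n, MvPolynomial (Fin (w n)) k), IsVNPnbFamily f →
      ∃ (a : ℕ → ℕ) (g : ∀ n, MvPolynomial (Fin (a n)) k) (v : ∀ n, Fin (a n) → Fin (w n))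
        (ℓ : ∀ n, Fin (a n) → ℕ), IsVNPFamily g ∧ (IsPBounded fun n => Finset.univ.sup (ℓ n)) ∧
          ∀ n, f n = MvPolynomial.aeval (fun z => (X (v n z) : MvPolynomial (Fin (w n)) k) ^
            2 ^ ℓ n z) (g n))
    (hVNP : ∀ (a : ℕ → ℕ) (g : ∀ n, MvPolynomial (Fin (a n)) k), IsVNPFamily g → IsVPFamily g)
    (w : ℕ → ℕ) (f : ∀ n, MvPolynomial (Fin (w n)) k) (hf : IsVNPnbFamily f) :
    IsVPnbFamily f := by
  obtain ⟨a, g, v, ℓ, hg, hℓ, hfg⟩ := hNF w f hf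
  have hw : IsPBounded fun n => Fintype.card (Fin (w n)) := by
    obtain ⟨u, G, hG, -⟩ := hf
    exact hG.1.mono fun n => by simp [Fintype.card_sum]
  have h := (hVNP a g hg).isVPnbFamily_powerSubst v ℓ hw hℓ
  refine (iff_of_eq (congrArg IsVPnbFamily (funext fun n => ?_))).1 h
  exact (hfg n).symm

end Literature.Computability.AlgebraicComplexity
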